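import Literature.Computability.MetaComplexity.ChenJinSanthanamWilliams2022.PalindromeRAM

/-!
# `PAL` in linear time AND constant space on the word RAM

A space supplement to `PalindromeRAM.lean`: the verified palindrome decider `palProg` writes
only to the three cells `0, 1, 2`, so along every run at most three cells are ever DIRTY in the
sense of the census's space convention (`ChenJinWilliams2019/UniformAdviceRAM.lean`, device
D16: `dirtyCells` = addresses whose content differs from the initial memory, counted with
`Set.encard`; `StaysWithinSpace`). Hence `PAL ∈ DTISPADV (fun n => n) (fun _ => 0) (fun _ => 0)`
(`PAL_mem_DTISPADV`: linear time, `O(1)` dirty words, no advice) — a non-trivial inhabitant of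
the time-space-advice classes over which the uniform-magnification rows R50 (item 1), R51 and
R26 are typed (so far inhabited in the tree only by `0` and `⊤`).

The one generic ingredient, stated for every program: if every instruction writes, if at all,
to a DIRECT address `< b` (`WritesBelow b`, a syntactic check), then no step changes a cell
`≥ b` (`step_mem_eq_of_writesBelow`), hence no run does (`reaches_mem_eq_of_writesBelow`).
Everything here is folklore; no cited fact, no `sorry`.
-/

namespace Literature.Computability.MetaComplexity.ChenJinSanthanamWilliams2022

open Literature.Computability.Cryptography Literature.Computability.Cryptography.WordRAM
open Literature.Computability.MetaComplexity.ChenJinWilliams2019 StateTransition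

/-! ## A syntactic write bound and what it guarantees -/

/-- `WritesBelow b ins`: the instruction `ins` writes nothing (jumps, `halt`, immediate
destinations) or writes to a direct address `< b`; indirect destinations and oracle queries
(which write an answer segment) are excluded. [folklore] -/
def WritesBelow (b : ℕ) : Instr → Bool
  | .op _ (.imm _) _ _ => true
  | .op _ (.dir d) _ _ => decide (d < b)
  | .op _ (.ind _) _ _ => false
  | .jmp _ => true
  | .jz _ _ => true
  | .rand (.imm _) => true
  | .rand (.dir d) => decide (d < b)
  | .rand (.ind _) => false
  | .query _ _ _ => false
  | .halt => true

/-- **One step of a program all of whose instructions write below `b` changes no cell `≥ b`.**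
[folklore] -/
theorem step_mem_eq_of_writesBelow {P : Program} {b : ℕ} (hP : ∀ ins ∈ P, WritesBelow b ins = true)
    {w : ℕ} {O : List ℕ → List ℕ} {ρ : ℕ → ℕ} {c c' : Cfg} (h : c' ∈ step P w O ρ c) {a : ℕ}
    (ha : b ≤ a) : c'.mem a = c.mem a := by
  rw [Option.mem_def] at h
  rcases hpc : c.pc with _ | i
  · rw [step_of_pc_eq_none hpc] at h; cases h
  · rcases hi : P[i]? with _ | ins
    · rw [step_of_getElem?_eq_none hpc hi] at h
      simp only [Option.some.injEq] at h; subst h; rfl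
    · have hw := hP ins (List.mem_of_getElem? hi)
      rcases ins with ⟨o, dst, x, y⟩ | t | ⟨x, t⟩ | dst | ⟨qa, ql, aa⟩ | _
      · rw [step_op hpc hi] at h
        simp only [Option.some.injEq] at h; subst h
        rcases dst with v | d | d
        · rfl
        · simp only [WritesBelow, decide_eq_true_eq] at hw
          exact Function.update_of_ne (by omega : a ≠ d) _ _
        · simp [WritesBelow] at hw
      · rw [step_jmp hpc hi] at h
        simp only [Option.some.injEq] at h; subst h; rfl
      · by_cases hx : x.read c.mem = 0
        · rw [step_jz_zero hpc hi hx] at h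
          simp only [Option.some.injEq] at h; subst h; rfl
        · rw [step_jz_ne hpc hi hx] at h
          simp only [Option.some.injEq] at h; subst h; rfl
      · rw [step_rand hpc hi] at h
        simp only [Option.some.injEq] at h; subst h
        rcases dst with v | d | d
        · rfl
        · simp only [WritesBelow, decide_eq_true_eq] at hw
          exact Function.update_of_ne (by omega : a ≠ d) _ _
        · simp [WritesBelow] at hw
      · simp [WritesBelow] at hw
      · rw [step_halt hpc hi] at h
        simp only [Option.some.injEq] at h; subst h; rfl

/-- Along any run of such a program, cells `≥ b` keep their initial content. [folklore] -/
theorem reaches_mem_eq_of_writesBelow {P : Program} {b : ℕ}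
    (hP : ∀ ins ∈ P, WritesBelow b ins = true) {w : ℕ} {O : List ℕ → List ℕ} {ρ : ℕ → ℕ}
    {c₀ c : Cfg} (h : Reaches (step P w O ρ) c₀ c) {a : ℕ} (ha : b ≤ a) : c.mem a = c₀.mem a := by
  unfold Reaches at h
  induction h with
  | refl => rfl
  | tail _ hbc ih => rw [step_mem_eq_of_writesBelow hP hbc ha, ih]

/-- Hence at most the cells `< b` are ever dirty: such a program stays within space `b` on every
input. [folklore] -/
theorem staysWithinSpace_of_writesBelow {P : Program} {b : ℕ}
    (hP : ∀ ins ∈ P, WritesBelow b ins = true) (w : ℕ) (inp : List ℕ) :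
    StaysWithinSpace P w inp b := by
  intro c hc
  have hsub : dirtyCells w inp c ⊆ Set.Iio b := by
    intro a ha
    by_contra hlt
    exact ha (reaches_mem_eq_of_writesBelow hP hc (by simpa using hlt))
  calc (dirtyCells w inp c).encard ≤ (Set.Iio b).encard := Set.encard_le_encard hsub
    _ = (b : ℕ∞) := by
      rw [← Finset.coe_range, Set.encard_coe_eq_coe_finsetCard, Finset.card_range]

/-! ## The palindrome decider writes only to cells `0, 1, 2` -/

/-- Every instruction of `palProg` writes below address `3`. [folklore] -/
theorem palProg_writesBelow : ∀ ins ∈ palProg, WritesBelow 3 ins = true := by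
  decide

/-- `palProg` stays within three dirty cells on every input. [folklore] -/
theorem palProg_staysWithinSpace (w : ℕ) (inp : List ℕ) : StaysWithinSpace palProg w inp 3 :=
  staysWithinSpace_of_writesBelow palProg_writesBelow w inp

/-- **`PAL ∈ DTISP_RAM[n, O(1)]` with no advice**: the palindromes are decided by a deterministic
oracle-free word-RAM program in `7n + 7` steps with at most `3 ≤ 7` dirty words and advice of
length `0` — a non-trivial member of the class `DTISPADV t s a` of the uniform-magnification
rows at the smallest parameters `t = id`, `s = 0`, `a = 0`. [folklore] -/
theorem PAL_mem_DTISPADV : PAL ∈ DTISPADV (fun n => n) (fun _ => 0) (fun _ => 0) := by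
  refine ⟨palProg, 1, 7, fun _ => [], palProg_isDeterministic, palProg_isOracleFree,
    fun n => by simp, fun x => ⟨palProg_decides x, ?_⟩⟩
  intro c hc
  exact (palProg_staysWithinSpace _ _ c hc).trans (by norm_num)

/-- Monotone consequence: `PAL ∈ DTISPADV t s a` for every `t ≥ id` and all `s`, `a`. [folklore] -/
theorem PAL_mem_DTISPADV_of_le {t : ℕ → ℕ} (ht : ∀ n, n ≤ t n) (s a : ℕ → ℕ) :
    PAL ∈ DTISPADV t s a :=
  DTISPADV_mono (t := fun n => n) ht (fun _ => Nat.zero_le _) (fun _ => Nat.zero_le _)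
    PAL_mem_DTISPADV

/-- `PAL ∈ DTIMEADV (fun n => n) (fun _ => 0)` (dropping the space clause). [folklore] -/
theorem PAL_mem_DTIMEADV : PAL ∈ DTIMEADV (fun n => n) (fun _ => 0) :=
  DTISPADV_subset_DTIMEADV _ (fun _ => 0) _ PAL_mem_DTISPADV

/-- Non-degeneracy of the time-space-advice classes beyond the constants: a member of
`DTISPADV id 0 0` that is neither `0` nor `⊤`. [folklore] -/
theorem exists_mem_DTISPADV_ne :
    ∃ L ∈ DTISPADV (fun n => n) (fun _ => 0) (fun _ => 0), L ≠ 0 ∧ L ≠ ⊤ :=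
  ⟨PAL, PAL_mem_DTISPADV, fun h => by simpa [h] using nil_mem_PAL,
    fun h => replicate_odd_not_mem_PAL 0 (by rw [h]; trivial)⟩

end Literature.Computability.MetaComplexity.ChenJinSanthanamWilliams2022
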